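import Mathlib
import Literature.Analysis.FluidPDE.Tao2016AveragedNS.ShiftSetCascadeFlows
import Summits.NavierStokesRegularity.NavierStokesRegularity.Theorems.TaoLadderRungTwoFlatCertificateGluePicardStepOn
import HarnessLib

/-!
# Certificate glue on a shift set `𝕊`, XIV: INPUTS DECOUPLED — a one-step certificate `StepCert` from an
  EXACT-FLOW step enclosure of the truncated (autonomous) window system plus a Grönwall allowance for the
  edge inputs (helper for item stmt-NavierStokesRegularity-22987 `FlatGapCertificatesV2`, crux K_A♭ of route
  TaoLadderRungTwoFlat, and for stmt-NavierStokesRegularity-24295 K_A₂(64); cell harvest/h2-tao-ladder, p1 g14)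

The mesh layer (glue X) needs, per step, an enclosure of all WINDOW RUNS — solutions of the window equations
driven by arbitrary continuous bounded EDGE INPUTS (a differential inclusion). Validated integrators (and the
tree's Taylor-model chain, `TaylorChain.CertData`) enclose the EXACT flow of an AUTONOMOUS polynomial system.
This module closes that gap once and for all: `stepCert_of_flowStep` derives `StepCert j` from

* an EXACT-FLOW STEP ENCLOSURE of the truncated window system `ẏ = F₀(y)` (edge shells frozen to `0`): from
  every state of the node box an exact solution exists on `[0,h]`, lies in the box `[Hlo, Hhi]` throughout and
  ends in `[N'lo, N'hi]` (what the autonomous integrator certifies);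
* a weighted LIPSCHITZ bound `K` of `F₀` on a region `G ⊇` the a priori `M`-box and the exact hull
  (`FieldLipOn`; from the bilinear structure, a finite computation);
* an INPUT-DEFECT bound `δ` (`InputDefectOn`: on `G`, the full field with admissible edge inputs differs from
  `F₀` by at most `δ·ω_k` — for nearest-neighbour `𝕊` only the two edge-adjacent shells contribute; tiny by the
  clocks behind and by the tail bound ahead);
* the Grönwall allowance `gronwallBound 0 K δ h ≤ A` and the inflated boxes `Hull j ⊇ [Hlo − Aω, Hhi + Aω]`,
  `Node (j+1) ⊇ [N'lo − Aω, N'hi + Aω]`.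

Proof: Mathlib's `dist_le_of_approx_trajectories_ODE_of_mem` in weighted window coordinates
(`(Fin m × Fin W) → ℝ`, sup norm), the run being a `δ`-approximate and the exact solution a `0`-approximate
trajectory of `F₀`, both inside `G` (the run by the a priori `M`-box — no first-exit argument needed).

HONEST FRAMING: Tao-type MODEL lattices (Tao 2016 §4/§6 vocabulary, shift-set parametrised); every enclosure /
bound is a HYPOTHESIS — nothing is computed or certified here, no stub is closed, and nothing here is a
statement about the Navier–Stokes equations.
-/

noncomputable section

-- the sub-problem namespace repeats the summit name by design (D-0017)
set_option linter.dupNamespace false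

namespace Summit.NavierStokesRegularity.NavierStokesRegularity.Theorems

open Set Filter Topology Literature.Analysis.FluidPDE Literature.Analysis.FluidPDE.TaoCascade

namespace CertificateGlueOn

variable {m : ℕ}

/-! ### The truncated field, Lipschitz and input-defect bounds -/

/-- The TRUNCATED (autonomous) window field: `quadTermOn` of the state with every shell outside `[-Kb, Ka]`
set to zero. [cite: Tao2016AveragedNS, §4 (4.8); cell vocabulary, window-truncated] -/
def truncField (𝕊 : Finset (ℤ × ℤ × ℤ)) (ε₀ : ℝ) (α : Fin m → Fin m → Fin m → ℤ × ℤ × ℤ → ℝ)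
    (Kb Ka : ℤ) (Y : Fin m → ℤ → ℝ) (i : Fin m) (k : ℤ) : ℝ :=
  quadTermOn 𝕊 ε₀ α (fun j n _ => if -Kb ≤ n ∧ n ≤ Ka then Y j n else 0) i k 0

/-- The truncated field reads only the window coordinates. [cite: Tao2016AveragedNS, §4 (4.8); cell vocabulary, window-truncated] -/
theorem truncField_congr (𝕊 : Finset (ℤ × ℤ × ℤ)) (ε₀ : ℝ) (α : Fin m → Fin m → Fin m → ℤ × ℤ × ℤ → ℝ)
    (Kb Ka : ℤ) {Y Y' : Fin m → ℤ → ℝ} (h : ∀ i k, -Kb ≤ k → k ≤ Ka → Y i k = Y' i k) :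
    truncField 𝕊 ε₀ α Kb Ka Y = truncField 𝕊 ε₀ α Kb Ka Y' := by
  have : (fun (j : Fin m) (n : ℤ) (_ : ℝ) => if -Kb ≤ n ∧ n ≤ Ka then Y j n else 0) =
      (fun (j : Fin m) (n : ℤ) (_ : ℝ) => if -Kb ≤ n ∧ n ≤ Ka then Y' j n else 0) := by
    funext j n u
    split_ifs with hn
    · exact h j n hn.1 hn.2
    · rfl
  funext i k
  simp only [truncField, this]

/-- **Weighted Lipschitz bound** of the truncated field on the window box `[lo, hi]` (weights `ω`, constant `K`).
[cite: MooreKearfottCloud2009, §6.2–6.4 (interval enclosures of ranges); cell certificate format, box layer] -/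
def FieldLipOn (𝕊 : Finset (ℤ × ℤ × ℤ)) (ε₀ : ℝ) (α : Fin m → Fin m → Fin m → ℤ × ℤ × ℤ → ℝ)
    (Kb Ka : ℤ) (ω : ℤ → ℝ) (lo hi : Fin m → ℤ → ℝ) (K : ℝ) : Prop :=
  ∀ (Y Y' : Fin m → ℤ → ℝ) (D : ℝ), 0 ≤ D → InBoxOn Kb Ka lo hi Y → InBoxOn Kb Ka lo hi Y' →
    (∀ i k, -Kb ≤ k → k ≤ Ka → |Y i k - Y' i k| ≤ D * ω k) →
      ∀ i k, -Kb ≤ k → k ≤ Ka →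
        |truncField 𝕊 ε₀ α Kb Ka Y i k - truncField 𝕊 ε₀ α Kb Ka Y' i k| ≤ K * D * ω k

/-- **Input-defect bound**: on the window box `[lo, hi]`, with admissible edge inputs, the full field differs
from the truncated one by at most `δ·ω_k`. [cite: MooreKearfottCloud2009, §6.2–6.4 (interval enclosures of ranges); cell certificate format, box layer] -/
def InputDefectOn (𝕊 : Finset (ℤ × ℤ × ℤ)) (ε₀ : ℝ) (α : Fin m → Fin m → Fin m → ℤ × ℤ × ℤ → ℝ)
    (Kb Ka : ℤ) (Eb Et : ℝ) (ω : ℤ → ℝ) (lo hi : Fin m → ℤ → ℝ) (δ : ℝ) : Prop :=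
  ∀ Y : Fin m → ℤ → ℝ, InBoxOn Kb Ka lo hi Y → (∀ i, |Y i (-Kb - 1)| ≤ Eb) → (∀ i, |Y i (Ka + 1)| ≤ Et) →
    ∀ i k, -Kb ≤ k → k ≤ Ka →
      |quadTermOn 𝕊 ε₀ α (fun j n _ => Y j n) i k 0 - truncField 𝕊 ε₀ α Kb Ka Y i k| ≤ δ * ω k

/-! ### Weighted window coordinates -/

/-- The number of window shells. [folklore] -/
def winLen (Kb Ka : ℤ) : ℕ := (Ka + Kb + 1).toNat

/-- The shell of a window column. [folklore] -/
def shellAt (Kb : ℤ) {W : ℕ} (c : Fin W) : ℤ := (c : ℤ) - Kb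

/-- Weighted window coordinates of a state: `(i, c) ↦ Y i (shell c) / ω (shell c)`. [folklore] -/
def wcoord (Kb Ka : ℤ) (ω : ℤ → ℝ) (Y : Fin m → ℤ → ℝ) : Fin m × Fin (winLen Kb Ka) → ℝ :=
  fun c => Y c.1 (shellAt Kb c.2) / ω (shellAt Kb c.2)

/-- The state with given weighted window coordinates (zero off the window). [folklore] -/
def wstate (Kb Ka : ℤ) (ω : ℤ → ℝ) (x : Fin m × Fin (winLen Kb Ka) → ℝ) : Fin m → ℤ → ℝ :=
  fun i k => if h : -Kb ≤ k ∧ k ≤ Ka then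
    ω k * x (i, ⟨(k + Kb).toNat, by
      unfold winLen
      rw [Int.toNat_lt_toNat (by omega)]
      omega⟩)
  else 0

variable {Kb Ka : ℤ} {ω : ℤ → ℝ}

/-- Every window column sits on a window shell. [folklore] -/
theorem shellAt_mem (hKK : 0 ≤ Ka + Kb + 1) (c : Fin (winLen Kb Ka)) :
    -Kb ≤ shellAt Kb c ∧ shellAt Kb c ≤ Ka := by
  have hc := c.2
  unfold winLen at hc
  have : ((c : ℕ) : ℤ) < Ka + Kb + 1 := by
    have h1 : ((c : ℕ) : ℤ) < (((Ka + Kb + 1).toNat : ℕ) : ℤ) := by exact_mod_cast hc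
    rwa [Int.toNat_of_nonneg hKK] at h1
  unfold shellAt
  constructor <;> omega

/-- `wstate ∘ wcoord` is the identity on the window. [folklore] -/
theorem wstate_wcoord (hω : ∀ k, 0 < ω k) (Y : Fin m → ℤ → ℝ) (i : Fin m) {k : ℤ} (hk1 : -Kb ≤ k)
    (hk2 : k ≤ Ka) : wstate Kb Ka ω (wcoord Kb Ka ω Y) i k = Y i k := by
  unfold wstate wcoord shellAt
  rw [dif_pos ⟨hk1, hk2⟩]
  have e : (((k + Kb).toNat : ℕ) : ℤ) - Kb = k := by rw [Int.toNat_of_nonneg (by omega)]; ring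
  simp only [e]
  field_simp [(hω k).ne']

/-- Off the window `wstate` vanishes. [folklore] -/
theorem wstate_off (x : Fin m × Fin (winLen Kb Ka) → ℝ) (i : Fin m) {k : ℤ} (hk : ¬(-Kb ≤ k ∧ k ≤ Ka)) :
    wstate Kb Ka ω x i k = 0 := by
  unfold wstate; rw [dif_neg hk]

/-- On the window `wstate x` is the weight times the coordinate. [folklore] -/
theorem wstate_on (x : Fin m × Fin (winLen Kb Ka) → ℝ) (hKK : 0 ≤ Ka + Kb + 1) (i : Fin m)
    (c : Fin (winLen Kb Ka)) : wstate Kb Ka ω x i (shellAt Kb c) = ω (shellAt Kb c) * x (i, c) := by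
  obtain ⟨h1, h2⟩ := shellAt_mem hKK c
  unfold wstate
  rw [dif_pos ⟨h1, h2⟩]
  congr 2
  rw [Prod.mk.injEq]
  exact ⟨rfl, Fin.ext (by simp [shellAt])⟩

/-- The truncated field of `wstate (wcoord Y)` is that of `Y`. [folklore] -/
theorem truncField_wstate_wcoord (𝕊 : Finset (ℤ × ℤ × ℤ)) (ε₀ : ℝ)
    (α : Fin m → Fin m → Fin m → ℤ × ℤ × ℤ → ℝ) (hω : ∀ k, 0 < ω k) (Y : Fin m → ℤ → ℝ) :
    truncField 𝕊 ε₀ α Kb Ka (wstate Kb Ka ω (wcoord Kb Ka ω Y)) = truncField 𝕊 ε₀ α Kb Ka Y :=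
  truncField_congr 𝕊 ε₀ α Kb Ka fun i _ hk1 hk2 => wstate_wcoord hω Y i hk1 hk2

/-- Componentwise weighted differences are bounded by the sup distance of the coordinates. [folklore] -/
theorem abs_wstate_sub_le (hω : ∀ k, 0 < ω k) (hKK : 0 ≤ Ka + Kb + 1)
    (x x' : Fin m × Fin (winLen Kb Ka) → ℝ) (i : Fin m) {k : ℤ} (hk1 : -Kb ≤ k) (hk2 : k ≤ Ka) :
    |wstate Kb Ka ω x i k - wstate Kb Ka ω x' i k| ≤ dist x x' * ω k := by
  have hlt : (k + Kb).toNat < winLen Kb Ka := by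
    unfold winLen; rw [Int.toNat_lt_toNat (by omega)]; omega
  set c : Fin (winLen Kb Ka) := ⟨(k + Kb).toNat, hlt⟩ with hc
  have hsh : shellAt Kb c = k := by
    simp only [shellAt, hc]; rw [Int.toNat_of_nonneg (by omega)]; ring
  have h1 := wstate_on (ω := ω) x hKK i c
  have h2 := wstate_on (ω := ω) x' hKK i c
  rw [hsh] at h1 h2
  rw [h1, h2, ← mul_sub, abs_mul, abs_of_pos (hω k), mul_comm]
  exact mul_le_mul_of_nonneg_right (by
    have := dist_le_pi_dist x x' (i, c)
    rwa [Real.dist_eq] at this) (hω k).le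

/-- A componentwise weighted bound on the window gives a sup-distance bound of the coordinates. [folklore] -/
theorem dist_wcoord_le (hω : ∀ k, 0 < ω k) (hKK : 0 ≤ Ka + Kb + 1) {Y Y' : Fin m → ℤ → ℝ} {D : ℝ}
    (hD : 0 ≤ D) (h : ∀ i k, -Kb ≤ k → k ≤ Ka → |Y i k - Y' i k| ≤ D * ω k) :
    dist (wcoord Kb Ka ω Y) (wcoord Kb Ka ω Y') ≤ D := by
  refine (dist_pi_le_iff hD).2 fun c => ?_
  obtain ⟨h1, h2⟩ := shellAt_mem hKK c.2
  rw [Real.dist_eq]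
  unfold wcoord
  rw [← sub_div, abs_div, abs_of_pos (hω _), div_le_iff₀ (hω _)]
  exact h c.1 _ h1 h2

/-- Conversely, the sup distance of the coordinates bounds every weighted window difference. [folklore] -/
theorem abs_sub_le_dist_wcoord (hω : ∀ k, 0 < ω k) (hKK : 0 ≤ Ka + Kb + 1) (Y Y' : Fin m → ℤ → ℝ)
    (i : Fin m) {k : ℤ} (hk1 : -Kb ≤ k) (hk2 : k ≤ Ka) :
    |Y i k - Y' i k| ≤ dist (wcoord Kb Ka ω Y) (wcoord Kb Ka ω Y') * ω k := by
  have h := abs_wstate_sub_le hω hKK (wcoord Kb Ka ω Y) (wcoord Kb Ka ω Y') i hk1 hk2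
  rwa [wstate_wcoord hω Y i hk1 hk2, wstate_wcoord hω Y' i hk1 hk2] at h

/-! ### Grönwall allowance -/

/-- `gronwallBound 0 K ε` is monotone in time for `K, ε ≥ 0`. [folklore] -/
theorem gronwallBound_mono {K ε x y : ℝ} (hK : 0 ≤ K) (hε : 0 ≤ ε) (hxy : x ≤ y) :
    gronwallBound 0 K ε x ≤ gronwallBound 0 K ε y := by
  rcases eq_or_lt_of_le hK with h | h
  · rw [← h, gronwallBound_K0]; simp only [zero_add]; exact mul_le_mul_of_nonneg_left hxy hε
  · rw [gronwallBound_of_K_ne_0 h.ne']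
    simp only [zero_mul, zero_add]
    have : Real.exp (K * x) ≤ Real.exp (K * y) := Real.exp_le_exp.2 (by nlinarith)
    have hεK : 0 ≤ ε / K := div_nonneg hε hK
    nlinarith

/-! ### The step theorem -/

variable {𝕊 : Finset (ℤ × ℤ × ℤ)} {ε₀ : ℝ} {α : Fin m → Fin m → Fin m → ℤ × ℤ × ℤ → ℝ} {Eb Et : ℝ}

/-- **`StepCert` FROM AN EXACT-FLOW STEP ENCLOSURE PLUS A GRÖNWALL ALLOWANCE FOR THE INPUTS** (see the module
docstring). [cite: MooreKearfottCloud2009, §9–10 (interval enclosure of ODE solutions); cell certificate format, mesh layer] -/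
theorem stepCert_of_flowStep (hKb : 0 ≤ Kb) (hKa : 1 ≤ Ka) (hω : ∀ k, 0 < ω k)
    {M : ℤ → ℝ} {t : ℕ → ℝ} {Node Hull : ℕ → (Fin m → ℤ → ℝ) → Prop} {j : ℕ}
    {Nlo Nhi N'lo N'hi Hlo Hhi glo ghi : Fin m → ℤ → ℝ} {K δ A : ℝ} (hK : 0 ≤ K) (hδ : 0 ≤ δ)
    (hN : ∀ y, Node j y → InBoxOn Kb Ka Nlo Nhi y)
    (hGM : ∀ i k, -Kb ≤ k → k ≤ Ka → glo i k ≤ -M k ∧ M k ≤ ghi i k)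
    (hGH : ∀ i k, -Kb ≤ k → k ≤ Ka → glo i k ≤ Hlo i k ∧ Hhi i k ≤ ghi i k)
    (hlip : FieldLipOn 𝕊 ε₀ α Kb Ka ω glo ghi K) (hdef : InputDefectOn 𝕊 ε₀ α Kb Ka Eb Et ω glo ghi δ)
    (hflow : ∀ z : Fin m → ℤ → ℝ, InBoxOn Kb Ka Nlo Nhi z → ∃ ψ : Fin m → ℤ → ℝ → ℝ,
      (∀ i k, -Kb ≤ k → k ≤ Ka → ψ i k 0 = z i k) ∧
      (∀ i k, -Kb ≤ k → k ≤ Ka → ∀ u ∈ Icc 0 (t (j + 1) - t j),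
        HasDerivWithinAt (ψ i k) (truncField 𝕊 ε₀ α Kb Ka (slice ψ u) i k) (Icc 0 (t (j + 1) - t j)) u) ∧
      (∀ u ∈ Icc 0 (t (j + 1) - t j), InBoxOn Kb Ka Hlo Hhi (slice ψ u)) ∧
      InBoxOn Kb Ka N'lo N'hi (slice ψ (t (j + 1) - t j)))
    (hA : gronwallBound 0 K δ (t (j + 1) - t j) ≤ A)
    (hH : ∀ y : Fin m → ℤ → ℝ,
      (∀ i k, -Kb ≤ k → k ≤ Ka → Hlo i k - A * ω k ≤ y i k ∧ y i k ≤ Hhi i k + A * ω k) → Hull j y)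
    (hN' : ∀ y : Fin m → ℤ → ℝ,
      (∀ i k, -Kb ≤ k → k ≤ Ka → N'lo i k - A * ω k ≤ y i k ∧ y i k ≤ N'hi i k + A * ω k) → Node (j + 1) y) :
    StepCert 𝕊 ε₀ α Kb Ka Eb Et M t Node Hull j := by
  intro s S hs hsh hnode hrun hM
  have hKK : 0 ≤ Ka + Kb + 1 := by omega
  set h := t (j + 1) - t j with hh
  obtain ⟨ψ, hψ0, hψd, hψH, hψN⟩ := hflow (slice S 0) (hN _ hnode)
  -- weighted coordinates of the run and of the exact solution
  set f : ℝ → (Fin m × Fin (winLen Kb Ka) → ℝ) := fun u => wcoord Kb Ka ω (slice S u) with hf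
  set g : ℝ → (Fin m × Fin (winLen Kb Ka) → ℝ) := fun u => wcoord Kb Ka ω (slice ψ u) with hg
  set v : (Fin m × Fin (winLen Kb Ka) → ℝ) → (Fin m × Fin (winLen Kb Ka) → ℝ) :=
    fun x => wcoord Kb Ka ω (truncField 𝕊 ε₀ α Kb Ka (wstate Kb Ka ω x)) with hv
  set T : Set (Fin m × Fin (winLen Kb Ka) → ℝ) := {x | InBoxOn Kb Ka glo ghi (wstate Kb Ka ω x)} with hT
  -- Lipschitz bound of `v` on `T`
  have hvlip : LipschitzOnWith K.toNNReal v T := by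
    refine LipschitzOnWith.of_dist_le_mul fun x hx x' hx' => ?_
    rw [Real.coe_toNNReal K hK]
    refine dist_wcoord_le hω hKK (mul_nonneg hK dist_nonneg) fun i k hk1 hk2 => ?_
    have := hlip (wstate Kb Ka ω x) (wstate Kb Ka ω x') (dist x x') dist_nonneg hx hx'
      (fun i' k' hk1' hk2' => abs_wstate_sub_le hω hKK x x' i' hk1' hk2') i k hk1 hk2
    exact this
  -- the run: derivative, continuity, defect, region
  have hSd : ∀ u ∈ Ico 0 s, HasDerivWithinAt f
      (wcoord Kb Ka ω (fun i k => quadTermOn 𝕊 ε₀ α S i k u)) (Ici u) u := by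
    intro u hu
    have hmem : Icc 0 s ∈ 𝓝[≥] u := mem_of_superset (Icc_mem_nhdsGE hu.2) (Icc_subset_Icc_left hu.1)
    refine HasDerivWithinAt.mono_of_mem_nhdsWithin ?_ hmem
    rw [hasDerivWithinAt_pi]
    intro c
    obtain ⟨h1, h2⟩ := shellAt_mem hKK c.2
    have := (hrun.deriv c.1 _ h1 h2 u (Ico_subset_Icc_self hu)).div_const (ω (shellAt Kb c.2))
    simpa [hf, wcoord, slice] using this
  have hSc : ContinuousOn f (Icc 0 s) := by
    rw [continuousOn_pi]
    intro c
    obtain ⟨h1, h2⟩ := shellAt_mem hKK c.2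
    simpa [hf, wcoord, slice] using (hrun.continuousOn c.1 h1 h2).div_const (ω (shellAt Kb c.2))
  have hST : ∀ u ∈ Ico 0 s, f u ∈ T := by
    intro u hu i k hk1 hk2
    simp only [hf]
    rw [wstate_wcoord hω _ i hk1 hk2, slice_apply]
    have hb := abs_le.mp (hM i k hk1 hk2 u (Ico_subset_Icc_self hu))
    have hg' := hGM i k hk1 hk2
    exact ⟨hg'.1.trans hb.1, hb.2.trans hg'.2⟩
  have hSdef : ∀ u ∈ Ico 0 s,
      dist (wcoord Kb Ka ω (fun i k => quadTermOn 𝕊 ε₀ α S i k u)) (v (f u)) ≤ δ := by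
    intro u hu
    have hu' := Ico_subset_Icc_self hu
    simp only [hv, hf]
    rw [truncField_wstate_wcoord 𝕊 ε₀ α hω]
    refine dist_wcoord_le hω hKK hδ fun i k hk1 hk2 => ?_
    have hY : InBoxOn Kb Ka glo ghi (slice S u) := fun i' k' hk1' hk2' => by
      have hb := abs_le.mp (hM i' k' hk1' hk2' u hu')
      have hg' := hGM i' k' hk1' hk2'
      simp only [slice_apply]
      exact ⟨hg'.1.trans hb.1, hb.2.trans hg'.2⟩
    have := hdef (slice S u) hY (fun i' => by simpa [slice] using hrun.bound_bot i' u hu')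
      (fun i' => by simpa [slice] using hrun.bound_top i' u hu') i k hk1 hk2
    rwa [quadTermOn_slice] at this
  -- the exact solution: derivative, continuity, region
  have hψd' : ∀ u ∈ Ico 0 s, HasDerivWithinAt g (v (g u)) (Ici u) u := by
    intro u hu
    have hus : u < h := lt_of_lt_of_le hu.2 hsh
    have hmem : Icc 0 h ∈ 𝓝[≥] u := mem_of_superset (Icc_mem_nhdsGE hus) (Icc_subset_Icc_left hu.1)
    refine HasDerivWithinAt.mono_of_mem_nhdsWithin ?_ hmem
    rw [hasDerivWithinAt_pi]
    intro c
    obtain ⟨h1, h2⟩ := shellAt_mem hKK c.2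
    have := (hψd c.1 _ h1 h2 u ⟨hu.1, hus.le⟩).div_const (ω (shellAt Kb c.2))
    simp only [hv, hg]
    rw [truncField_wstate_wcoord 𝕊 ε₀ α hω]
    simpa [wcoord, slice] using this
  have hψc : ContinuousOn g (Icc 0 s) := by
    rw [continuousOn_pi]
    intro c
    obtain ⟨h1, h2⟩ := shellAt_mem hKK c.2
    have : ContinuousOn (ψ c.1 (shellAt Kb c.2)) (Icc 0 h) := fun u hu =>
      (hψd c.1 _ h1 h2 u hu).continuousWithinAt
    simpa [hg, wcoord, slice] using (this.mono (Icc_subset_Icc_right hsh)).div_const (ω (shellAt Kb c.2))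
  have hψT : ∀ u ∈ Ico 0 s, g u ∈ T := by
    intro u hu i k hk1 hk2
    simp only [hg]
    rw [wstate_wcoord hω _ i hk1 hk2]
    have hb := hψH u ⟨hu.1, (lt_of_lt_of_le hu.2 hsh).le⟩ i k hk1 hk2
    have hg' := hGH i k hk1 hk2
    exact ⟨hg'.1.trans hb.1, hb.2.trans hg'.2⟩
  have hψdef : ∀ u ∈ Ico 0 s, dist (v (g u)) (v (g u)) ≤ 0 := fun u _ => by rw [dist_self]
  -- same start
  have h0 : dist (f 0) (g 0) ≤ 0 := by
    refine le_of_eq (dist_eq_zero.2 ?_)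
    funext c
    obtain ⟨h1, h2⟩ := shellAt_mem hKK c.2
    simp only [hf, hg, wcoord, slice_apply, hψ0 c.1 _ h1 h2]
  -- Grönwall
  have hgr := dist_le_of_approx_trajectories_ODE_of_mem (v := fun _ => v) (s := fun _ => T)
    (fun u _ => hvlip) hSc hSd hSdef hST hψc hψd' hψdef hψT h0
  -- componentwise extraction
  have hdev : ∀ u ∈ Icc 0 s, ∀ i k, -Kb ≤ k → k ≤ Ka → |S i k u - ψ i k u| ≤ A * ω k := by
    intro u hu i k hk1 hk2
    have h1 := abs_sub_le_dist_wcoord hω hKK (slice S u) (slice ψ u) i hk1 hk2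
    simp only [slice_apply] at h1
    have h2 := hgr u hu
    rw [add_zero, sub_zero, Real.coe_toNNReal K hK] at h2
    have h3 : gronwallBound 0 K δ u ≤ A :=
      (gronwallBound_mono hK hδ (hu.2.trans hsh)).trans hA
    calc |S i k u - ψ i k u| ≤ dist (f u) (g u) * ω k := h1
      _ ≤ A * ω k := mul_le_mul_of_nonneg_right (h2.trans h3) (hω k).le
  refine ⟨fun u hu => hH _ fun i k hk1 hk2 => ?_, fun hsfull => hN' _ fun i k hk1 hk2 => ?_⟩
  · have hd := abs_le.mp (hdev u hu i k hk1 hk2)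
    have hb := hψH u ⟨hu.1, hu.2.trans hsh⟩ i k hk1 hk2
    simp only [slice_apply] at hb ⊢
    constructor <;> linarith [hd.1, hd.2, hb.1, hb.2]
  · have hd := abs_le.mp (hdev s ⟨hs.le, le_rfl⟩ i k hk1 hk2)
    have hb := hψN i k hk1 hk2
    simp only [slice_apply] at hb ⊢
    rw [← hsfull] at hb
    constructor <;> linarith [hd.1, hd.2, hb.1, hb.2]

end CertificateGlueOn

end Summit.NavierStokesRegularity.NavierStokesRegularity.Theorems

end
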